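import Mathlib
import HarnessLib
import Summits.RiemannHypothesis.RiemannHypothesis.Theorems.IntegerScrewRung128
import Summits.RiemannHypothesis.RiemannHypothesis.Theorems.IntegerScrewTailCheck

/-!
# Route `IntegerScrew` — top-block pairing negativity of the Nyquist-floor dual `D16`, HEAD `31 ≤ N ≤ 128`

The RH-free obstruction `NyquistFloor` for manifest-wave certificates of the screw matrices (SCREW column,
rh-explicit cell; sos-theory's `ScrewManifestCert`: `TopBlockD16Works = TopBlockPairingNeg 31 ∧ TopBlockWavePos …`)
needs the PAIRING NEGATIVITY of the fixed 110-edge integer design `D16 = (a_e, b_e, k_e)` on the top 16 nodes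
against `S_N`:  `G_N := Σ_e k_e Ψ(log(N − a_e) − log(N − b_e)) < 0` for all `N ≥ 31`.
THIS FILE: the HEAD `31 ≤ N ≤ 128`, read off the TREE's kernel-certified entry table of `S_128`
(`RungCert.utab127 ∋ u(a,b) = Ψ(log(a/b)) − C/4`, `b < a ≤ 128`, `IntegerScrewRung128`): every head pair
`(N − a_e, N − b_e)` lies in that table, so `G_N = Σ_e k_e u(N−a_e, N−b_e) + (Σ_e k_e)·C/4 ≤ hi/2^48 + 77 911·C_hi/4`,
with the NEW two-sided bound `C ≤ cHiQ` (`Σ_{k≥K}(k+¼)^{-2} ≤ 1/(K−¾)`, telescoping).  One `decide +kernel`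
over `98 × 110` table look-ups (`headCheck_utab127`).  The TAIL `N ≥ 129` is the small-argument expansion of
`Ψ` (`Literature.…ZetaScrewSmallArg`).  Nothing here bears on the truth of RH (RH-free finite inequalities).
References: M. Suzuki, J. Lond. Math. Soc. (2) 108 (2023), (1.1) [Suzuki2023]; S. M. Rump, Acta Numerica 19
(2010) §10.8 [folklore].
-/

set_option linter.dupNamespace false
set_option autoImplicit false

namespace Summit.RiemannHypothesis.RiemannHypothesis.Theorems.IntegerScrew.TopBlockNeg

open Literature.NumberTheory.LFunctions Literature.Analysis.ValidatedNumerics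
open Literature.Analysis.ValidatedNumerics.Numerics Finset RungCert

/-! ## The design `D16` and the pairing `G_N` -/

-- `d16 : List (ℕ × ℕ × ℤ)` (the design D16 = sos-theory's tbA/tbB/tbK) is defined in
-- `IntegerScrewTailCheck` (same namespace).

/-- Shape facts of the design: `a_e < b_e ≤ 15` on every edge. [folklore] -/
theorem d16_shape : ∀ t ∈ d16, t.1 < t.2.1 ∧ t.2.1 ≤ 15 := by
  have h : (d16.all fun t => decide (t.1 < t.2.1) && decide (t.2.1 ≤ 15)) = true := by decide +kernel
  intro t ht
  have := List.all_eq_true.1 h t ht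
  simpa [Bool.and_eq_true, decide_eq_true_eq] using this

/-- `Σ_e k_e = 77 911`. [folklore] -/
theorem d16_sumK : (d16.map fun t => t.2.2).sum = 77911 := by decide +kernel

/-- The pairing `G_N = Σ_e k_e Ψ(log(N − a_e) − log(N − b_e))` of `D16` with the screw matrix `S_N`
(top node `N`; in sos-theory's notation `Σ_e tbC e · zetaScrew (tbD N e)`). [folklore] -/
noncomputable def topPairing (N : ℕ) : ℝ :=
  (d16.map fun t => (t.2.2 : ℝ) * zetaScrew (Real.log ((N : ℝ) - t.1) - Real.log ((N : ℝ) - t.2.1))).sum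

/-! ## An upper bound for `C = ζ(2,¼)` -/

/-- A rational upper bound of `C = ζ(2,¼)`: `Σ_{k<K} (k+¼)^{-2} + 1/(K−¾)` rounded up (`K = cTerms = 300`). [folklore] -/
def cHiQ : ℚ := ((cPartial cTerms).hi : ℚ) / SC + 4 / (4 * cTerms - 3)

/-- Telescoping tail bound: `Σ_{K ≤ k < K'} (k+¼)^{-2} ≤ 1/(K−¾)` (`K ≥ 1`). [folklore] -/
theorem sum_Ico_quarter_sq_le {K K' : ℕ} (hK : 1 ≤ K) (h : K ≤ K') :
    ∑ k ∈ Finset.Ico K K', 1 / ((k : ℝ) + 1 / 4) ^ 2 ≤ 1 / ((K : ℝ) - 3 / 4) - 1 / ((K' : ℝ) - 3 / 4) := by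
  induction K', h using Nat.le_induction with
  | base => simp
  | succ K' hge ih =>
      rw [Finset.sum_Ico_succ_top hge]
      have hK'r : (1 : ℝ) ≤ K' := by exact_mod_cast (hK.trans hge)
      have hstep : 1 / ((K' : ℝ) + 1 / 4) ^ 2 ≤ 1 / ((K' : ℝ) - 3 / 4) - 1 / (((K' + 1 : ℕ) : ℝ) - 3 / 4) := by
        push_cast
        rw [div_sub_div _ _ (by linarith) (by linarith), div_le_div_iff₀ (by positivity) (by nlinarith)]
        nlinarith
      linarith

/-- **Upper bound of `C`**: `C ≤ Σ_{k<K}(k+¼)^{-2} + 1/(K−¾)` (`K ≥ 1`). [folklore] -/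
theorem lerchC_le_partial_add (K : ℕ) (hK : 1 ≤ K) :
    lerchC ≤ ∑ k ∈ range K, 1 / ((k : ℝ) + 1 / 4) ^ 2 + 1 / ((K : ℝ) - 3 / 4) := by
  unfold lerchC
  refine Real.tsum_le_of_sum_range_le (fun n => by positivity) fun n => ?_
  rcases le_or_gt n K with hn | hn
  · have h1 : ∑ i ∈ range n, 1 / ((i : ℝ) + 1 / 4) ^ 2 ≤ ∑ i ∈ range K, 1 / ((i : ℝ) + 1 / 4) ^ 2 :=
      Finset.sum_le_sum_of_subset_of_nonneg (Finset.range_mono hn) fun i _ _ => by positivity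
    have h2 : (0 : ℝ) ≤ 1 / ((K : ℝ) - 3 / 4) := by
      have : (1 : ℝ) ≤ K := by exact_mod_cast hK
      exact div_nonneg zero_le_one (by linarith)
    linarith
  · have hsplit : ∑ i ∈ range n, 1 / ((i : ℝ) + 1 / 4) ^ 2 =
        ∑ i ∈ range K, 1 / ((i : ℝ) + 1 / 4) ^ 2 + ∑ i ∈ Finset.Ico K n, 1 / ((i : ℝ) + 1 / 4) ^ 2 := by
      rw [Finset.range_eq_Ico, Finset.range_eq_Ico, ← Finset.sum_Ico_consecutive _ (Nat.zero_le K) hn.le]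
    have htail := sum_Ico_quarter_sq_le hK hn.le
    have hpos : (0 : ℝ) ≤ 1 / ((n : ℝ) - 3 / 4) := by
      have : (1 : ℝ) ≤ K := by exact_mod_cast hK
      have : (K : ℝ) < n := by exact_mod_cast hn
      exact div_nonneg zero_le_one (by linarith)
    linarith

/-- **`C ≤ cHiQ`.** [folklore] -/
theorem lerchC_le_cHiQ : lerchC ≤ ((cHiQ : ℚ) : ℝ) := by
  have h1 := (mem_cPartial cTerms).2
  have h2 := lerchC_le_partial_add cTerms (by unfold cTerms; norm_num)
  have hS := SC_pos
  have h3 : ∑ k ∈ range cTerms, 1 / ((k : ℝ) + 1 / 4) ^ 2 ≤ (((cPartial cTerms).hi : ℤ) : ℝ) / SC := by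
    rw [le_div_iff₀ hS]; exact h1
  have h4 : ((cHiQ : ℚ) : ℝ) = (((cPartial cTerms).hi : ℤ) : ℝ) / SC + 4 / (4 * (cTerms : ℝ) - 3) := by
    unfold cHiQ; push_cast; ring
  have h5 : (4 : ℝ) / (4 * (cTerms : ℝ) - 3) = 1 / ((cTerms : ℝ) - 3 / 4) := by
    have : (4 : ℝ) * (cTerms : ℝ) - 3 ≠ 0 := by unfold cTerms; norm_num
    rw [div_eq_div_iff this (by unfold cTerms; norm_num)]; ring
  rw [h4, h5]
  linarith

/-! ## The head checker -/

/-- Enclosure of `Σ_e k_e u(N − a_e, N − b_e)` from an entry table. [folklore] -/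
def headEncl (utab : List (List FI)) (N : ℕ) : FI :=
  d16.foldr (fun t acc => ((ug utab (N - t.1) (N - t.2.1)).mulInt t.2.2).add acc) (FI.ofInt 0)

/-- The head test at `N`: `hi(Σ k_e u)/2^48 + 77 911·cHiQ/4 < 0`. [folklore] -/
def headRowOK (utab : List (List FI)) (N : ℕ) : Bool :=
  decide ((((headEncl utab N).hi : ℤ) : ℚ) / SC + 77911 * cHiQ / 4 < 0)

/-- The head test for `N0, …, N1`. [folklore] -/
def headCheck (utab : List (List FI)) (N0 N1 : ℕ) : Bool :=
  (List.range (N1 + 1 - N0)).all fun i => headRowOK utab (N0 + i)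

/-- Soundness of the fold: if every needed table entry encloses `u`, then `headEncl` encloses the weighted sum. [folklore] -/
theorem mem_headEncl_aux (utab : List (List FI)) (N : ℕ)
    (hut : ∀ a b : ℕ, 0 < b → b < a → a ≤ 128 → FI.mem (uR a b) (ug utab a b)) (hN : 31 ≤ N) (hN' : N ≤ 128) :
    ∀ L : List (ℕ × ℕ × ℤ), (∀ t ∈ L, t.1 < t.2.1 ∧ t.2.1 ≤ 15) →
      FI.mem (L.map fun t => (t.2.2 : ℝ) * uR (N - t.1) (N - t.2.1)).sum
        (L.foldr (fun t acc => ((ug utab (N - t.1) (N - t.2.1)).mulInt t.2.2).add acc) (FI.ofInt 0))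
  | [], _ => by simpa using FI.mem_ofInt 0
  | t :: L, hL => by
      simp only [List.map_cons, List.sum_cons, List.foldr_cons]
      have ht := hL t (by simp)
      have hrest := mem_headEncl_aux utab N hut hN hN' L fun s hs => hL s (by simp [hs])
      have hu := hut (N - t.1) (N - t.2.1) (by omega) (by omega) (by omega)
      have := FI.mem_add (FI.mem_mulInt hu t.2.2) hrest
      simpa [mul_comm] using this

/-- The pairing as a sum of table entries plus the `C`-term: for `31 ≤ N`,
`G_N = Σ_e k_e u(N−a_e, N−b_e) + 77 911·C/4`. [folklore] -/
theorem topPairing_eq_uR {N : ℕ} (hN : 31 ≤ N) :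
    topPairing N = (d16.map fun t => (t.2.2 : ℝ) * uR (N - t.1) (N - t.2.1)).sum + 77911 * lerchC / 4 := by
  have key : ∀ L : List (ℕ × ℕ × ℤ), (∀ t ∈ L, t.1 < t.2.1 ∧ t.2.1 ≤ 15) →
      (L.map fun t => (t.2.2 : ℝ) * zetaScrew (Real.log ((N : ℝ) - t.1) - Real.log ((N : ℝ) - t.2.1))).sum
        = (L.map fun t => (t.2.2 : ℝ) * uR (N - t.1) (N - t.2.1)).sum
          + ((L.map fun t => t.2.2).sum : ℤ) * lerchC / 4 := by
    intro L hL
    induction L with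
    | nil => simp
    | cons t L ih =>
        have ht := hL t (by simp)
        have ih' := ih fun s hs => hL s (by simp [hs])
        simp only [List.map_cons, List.sum_cons]
        rw [ih']
        have h1 : ((N - t.1 : ℕ) : ℝ) = (N : ℝ) - t.1 := by push_cast [show t.1 ≤ N by omega]; ring
        have h2 : ((N - t.2.1 : ℕ) : ℝ) = (N : ℝ) - t.2.1 := by push_cast [show t.2.1 ≤ N by omega]; ring
        have hp : (0 : ℝ) < (N : ℝ) - t.1 := by
          have : (t.1 : ℝ) + 16 ≤ N := by exact_mod_cast (show t.1 + 16 ≤ N by omega)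
          linarith
        have hq : (0 : ℝ) < (N : ℝ) - t.2.1 := by
          have : (t.2.1 : ℝ) + 16 ≤ N := by exact_mod_cast (show t.2.1 + 16 ≤ N by omega)
          linarith
        have hlog : Real.log ((N : ℝ) - t.1) - Real.log ((N : ℝ) - t.2.1)
            = Real.log (((N - t.1 : ℕ) : ℝ) / ((N - t.2.1 : ℕ) : ℝ)) := by
          rw [h1, h2, Real.log_div hp.ne' hq.ne']
        rw [hlog, uR]
        push_cast
        ring
  rw [topPairing, key d16 d16_shape, d16_sumK]
  push_cast
  ring

/-- **Soundness of the head checker**: if the table encloses every `u(a,b)`, `b < a ≤ 128`, and the head test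
passes for `N0 … N1` (`31 ≤ N0`, `N1 ≤ 128`), then `G_N < 0` on that range. [folklore] -/
theorem topPairing_neg_of_headCheck {utab : List (List FI)}
    (hut : ∀ a b : ℕ, 0 < b → b < a → a ≤ 128 → FI.mem (uR a b) (ug utab a b))
    {N0 N1 : ℕ} (h0 : 31 ≤ N0) (h1 : N1 ≤ 128) (hc : headCheck utab N0 N1 = true)
    {N : ℕ} (hN0 : N0 ≤ N) (hN1 : N ≤ N1) : topPairing N < 0 := by
  unfold headCheck at hc
  rw [List.all_eq_true] at hc
  have hrow : headRowOK utab N = true := by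
    have := hc (N - N0) (by rw [List.mem_range]; omega)
    rwa [show N0 + (N - N0) = N by omega] at this
  unfold headRowOK at hrow
  rw [decide_eq_true_eq] at hrow
  have hmem := mem_headEncl_aux utab N hut (by omega) (by omega) d16 d16_shape
  have hS := SC_pos
  have hup : (d16.map fun t => (t.2.2 : ℝ) * uR (N - t.1) (N - t.2.1)).sum
      ≤ (((headEncl utab N).hi : ℤ) : ℝ) / SC := by
    rw [le_div_iff₀ hS]; exact hmem.2
  have hC := lerchC_le_cHiQ
  have hq : ((((headEncl utab N).hi : ℤ) : ℚ) / SC + 77911 * cHiQ / 4 : ℚ) < 0 := hrow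
  have hq' : (((headEncl utab N).hi : ℤ) : ℝ) / SC + 77911 * ((cHiQ : ℚ) : ℝ) / 4 < 0 := by
    have := (Rat.cast_lt (K := ℝ)).2 hq
    push_cast at this
    exact this
  rw [topPairing_eq_uR (by omega)]
  linarith

/-! ## The tree's `S_128` table and the head `31 ≤ N ≤ 128` -/

/-- Every entry of the tree's table `utab127` encloses `u(a,b)`, `0 < b < a ≤ 128` (the light checks
`RungCert.light127`, the slope literal `RungCert.slope127_eq` and the table identity `RungCert.utab127_eq` of
`IntegerScrewRung128`). [folklore] -/
theorem mem_ug_utab127 : ∀ a b : ℕ, 0 < b → b < a → a ≤ 128 → FI.mem (uR a b) (ug utab127 a b) := by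
  intro a b hb hba ha
  have h := light127
  unfold rungLightW at h
  simp only [Bool.and_eq_true, decide_eq_true_eq] at h
  obtain ⟨⟨⟨⟨⟨hlam, hsq⟩, hlogs⟩, hok⟩, _⟩, _⟩ := h
  have hL := logsOK_of_eq hlogs hok
  have hΛ := fun n hn => lamTabOK_sound hlam (n := n) hn
  have hS := fun n hn => mem_of_sqrtTabOK hsq (n := n) hn
  have hAv : FI.mem slopeA slope127 := mem_slopeEncl hL (by omega) slope127_eq
  rw [utab127_eq, ug_uTableW hba ha]
  exact mem_uEnclW hΛ hS hL hAv hb hba ha _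

/-- KERNEL: the head test passes on the tree's table for `31 ≤ N ≤ 128`. [folklore] -/
theorem headCheck_utab127 : headCheck utab127 31 128 = true := by
  decide +kernel

/-- **HEAD of the top-block pairing negativity**: `G_N < 0` for `31 ≤ N ≤ 128`, unconditionally. [folklore] -/
theorem topPairing_neg_of_le_128 {N : ℕ} (h31 : 31 ≤ N) (h128 : N ≤ 128) : topPairing N < 0 :=
  topPairing_neg_of_headCheck mem_ug_utab127 le_rfl le_rfl headCheck_utab127 h31 h128

end Summit.RiemannHypothesis.RiemannHypothesis.Theorems.IntegerScrew.TopBlockNeg
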